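import Summits.Ventures.PackingBounds.ThreePointCert.K6Cert

/-!
# κ(6) ≤ 79 (three-point bound, kernel-checked): kernel validation of Gram block R0 (chunks 5–8 of 19)

Framing: lottery ticket; floor = certified bounds/negative ranges. Venture `PackingBounds` (cell
`pub-packcert`), three-point SDP family. Integer data of a feasible point of the Bachoc–Vallentin
semidefinite program (n = 6, s = 1/2, degree d = 9, symmetric
sums of squares), derived by `pub-packcert-sdp/code/cert2lean.py` from the exact rational
certificate `sdp-n6-d9-s1-2-sym.json` of the cell (two independent exact verifiers + referee), in the
units of the kernel checker `ThreePointCert.Check` (soundness `ThreePointCert.Sound`). Generated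
file: plain lists of integers / monomials.
-/

namespace Summit.Ventures.PackingBounds.ThreePointCert.K6

open Literature.Geometry.DiscreteGeometry Literature.Geometry.DiscreteGeometry.PolyCert PolyCert.SPoly

set_option maxHeartbeats 0 in
/-- Block `R0`: rows from 90 (12 rows) of `zᵀ(LLᵀ)z` added to `dR0c4` give `dR0c5` (kernel). -/
theorem okR0_5 : chunkOK K6.gR0 90 12 K6.dR0c4 K6.dR0c5 = true := by
  decide +kernel

set_option maxHeartbeats 0 in
/-- Block `R0`: rows from 102 (11 rows) of `zᵀ(LLᵀ)z` added to `dR0c5` give `dR0c6` (kernel). -/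
theorem okR0_6 : chunkOK K6.gR0 102 11 K6.dR0c5 K6.dR0c6 = true := by
  decide +kernel

set_option maxHeartbeats 0 in
/-- Block `R0`: rows from 113 (10 rows) of `zᵀ(LLᵀ)z` added to `dR0c6` give `dR0c7` (kernel). -/
theorem okR0_7 : chunkOK K6.gR0 113 10 K6.dR0c6 K6.dR0c7 = true := by
  decide +kernel

set_option maxHeartbeats 0 in
/-- Block `R0`: rows from 123 (9 rows) of `zᵀ(LLᵀ)z` added to `dR0c7` give `dR0c8` (kernel). -/
theorem okR0_8 : chunkOK K6.gR0 123 9 K6.dR0c7 K6.dR0c8 = true := by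
  decide +kernel

end Summit.Ventures.PackingBounds.ThreePointCert.K6
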